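/- Width seat `ym-line-cbag-p1-w3` (prover-ym-line-cbag-p1-w3-g5-0), route `ColdBoxAllGroups` (planner-of-record ym-idea-2; cruxes
stmt-QuantumFields-22254 / 22255 CLOSED proved): the EXPLICIT `G`-uniform exponent WITHOUT simplicity — merge of the lead's
`…XiPowExplicit` (ε = 1/8000, compact simple `G`) with w2's hypothesis audit `…{BoxFloor,Bulk,XiPow}DimEPos` (`0 < dimE` suffices). -/
import Summits.QuantumFields.YangMills.Theorems.ColdBoxAllGroupsBulkSmallWindows
import Summits.QuantumFields.YangMills.Theorems.ColdBoxAllGroupsXiPowDimEPos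

/-!
# `ξ(β) ≥ β^{1/8000}` for EVERY compact gauge group of positive dimension — explicit exponent, no simplicity

Two records of the closed route `ColdBoxAllGroups` are merged here:
* the lead's explicit, `G`-UNIFORM exponent (`ColdBoxAllGroups.xiPow_uniform`, `Theorems/ColdBoxAllGroupsXiPowExplicit.lean`):
  `∃ ε = 1/8000, ∀ compact simple G, ∀ r, MassGapPowerDecayOf 4 r.ρ ε` — stated under `IsCompactSimpleLieGroup G`;
* w2's hypothesis audit (`Theorems/ColdBoxAllGroups{BoxFloor,Bulk,XiPow}DimEPos.lean`): simplicity is consumed only as `0 < dimE r.ρ`, so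
  `∀ compact G, ∀ r with 0 < dimE r.ρ, ∃ ε > 0, MassGapPowerDecayOf 4 r.ρ ε` — but `∃ ε`-packaged (`bulkDominatesBox_of_dimE_pos` hides its window).

At the level of a faithful continuous unitary `ρ : G →* U(N)` with `0 < dimE ρ` every BULK stub has an explicit-window form in the tree
(`kernelCovExpansionG_of_le`, `kernelMeanExpansionG_of_dimE_pos`, `goodBoundaryCovStableG_at`, `goodBoundaryMeanSmoothG_at`,
`boxPolyFloorG_of_boxTwoPointDomination`, `boxTwoPointDomination_of_dimE_pos`, `boxDirichletDominationAbs_of_rep`), so the composition runs at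
fixed exponents without `IsCompactSimpleLieGroup`:

* `flatCovExpansion_of_rep` — N2-flat at every `0 < θ ≤ 1/100`, any faithful unitary `ρ`;
* `goodBoundaryCovStable_explicit_of_dimE_pos`, `goodBoundaryMeanSmooth_explicit_of_dimE_pos`, `boxPolyFloor_explicit_of_dimE_pos` — L1a / L1b
  (`0 < θ ≤ 1/200`) and L4 (`0 < θ ≤ 1/100`) along `(A, δ, K) = (θ/20, θ/5, 2 + θ/2)`, for `0 < dimE ρ`;
* `bulkDominatesBox_explicit_of_dimE_pos` — **BULK for every compact `G`, every `r : LatticeRep G` with `0 < dimE r.ρ`, at every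
  `0 < θ ≤ 1/200`: `BulkDominatesBox r.ρ (θ/20) θ`**; and by the box-size transfer (`bulkDominatesBox_rewindow_of_dimE_pos`,
  `Theorems/ColdBoxAllGroupsBulkSmallWindows.lean`) `bulkDominatesBox_smallWindows_of_dimE_pos` — at EVERY window `0 < A ≤ 1/4000`,
  `A < θ ≤ 1/100` (with BOX: `boxAndBulk_smallWindows_of_dimE_pos`);
* `massGapPowerDecay_explicit_of_dimE_pos` — **`MassGapPowerDecayOf 4 r.ρ (1/8000)` for every compact `G` and every `r` with `0 < dimE r.ρ`**;
  `xiPow_uniform_of_dimE_pos` — the quantifier-swapped form `∃ ε > 0, ∀ G, ∀ r, 0 < dimE r.ρ → MassGapPowerDecayOf 4 r.ρ ε`;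
* `massGapPowerDecay_explicit_of_connected` — every nontrivial connected compact `G` (faithfully, unitarily represented) at `ε = 1/8000`;
  instances `massGapPowerDecay_explicit_unitaryGroup` (`U(N+1)`, any `r`) and `massGapPowerDecay_explicit_u1Rep` (`U(1) = Circle`, `u1Rep`:
  lattice QED₄, whose weak-coupling phase is massless — the BC5-type witness of weakness of the rung, now with the explicit exponent).

No sorry; no new definition; standard axioms.  HONEST LABEL: a RECORD-label statement (power-rate UPPER bound `≤ β^{−1/8000}` on the lattice
RP-spectral mass gap of torus-limit states at weak coupling, i.e. `ξ ≥ β^{1/8000}`); NOT the Clay Yang–Mills mass gap; no summit statement is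
proved by anything here.
-/

set_option autoImplicit false

noncomputable section

open MeasureTheory Filter Topology Real
open Literature.MathematicalPhysics.QuantumLattice
open Literature.MathematicalPhysics.QuantumFieldTheory
open Literature.MathematicalPhysics.QuantumFieldTheory.LatticeMaxwell
open Summit.QuantumFields.YangMills.Theorems.WeakCouplingRates
open Summit.QuantumFields.YangMills.Theorems.FreeEnergyLogCoefficient (dimE)

namespace Summit.QuantumFields.YangMills.Theorems.ColdBoxAllGroups

/-! ## 1. The BULK stubs at fixed exponents, any faithful unitary `ρ` with `0 < dimE ρ` -/

section Rep

variable {N : ℕ} {G : Type} [Group G] [TopologicalSpace G] [IsTopologicalGroup G] [CompactSpace G]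
  [MeasurableSpace G] [BorelSpace G] (ρ : G →* Matrix (Fin N) (Fin N) ℂ)

/-- **N2-flat without simplicity, at every `0 < θ ≤ 1/100`**: `FlatCovExpansionG ρ (θ/20) θ` — the cold-wall two-plaquette covariance at
separation `⌈β^{θ/20}⌉` is its Dirichlet–Gaussian value `(D/2)·K²` up to `β^{−θ/2}` (from `boxDirichletDominationAbs_of_rep`, `κ = 9θ`; the body
of `flatCovExpansionG_explicit` with `r.ρ ↦ ρ`). -/
theorem flatCovExpansion_of_rep (hρc : Continuous ρ) (hinj : Function.Injective ρ)
    (hρu : ∀ g, ρ g ∈ Matrix.unitaryGroup (Fin N) ℂ) {θ : ℝ} (hθ : 0 < θ) (hθ1 : θ ≤ 1 / 100) :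
    FlatCovExpansionG ρ (θ / 20) θ := by
  obtain ⟨β₁, h₁⟩ := boxDirichletDominationAbs_of_rep ρ hρc hinj hρu hθ hθ1
  unfold FlatCovExpansionG
  refine ⟨max β₁ 1, fun β hβ => ?_⟩
  have hβ₁ : β₁ ≤ β := le_trans (le_max_left _ _) hβ
  have hβ1 : (1 : ℝ) ≤ β := le_trans (le_max_right _ _) hβ
  have hT : ⌈β ^ (θ / 20)⌉₊ ≤ ⌈β ^ θ⌉₊ :=
    Nat.ceil_mono (Real.rpow_le_rpow_of_exponent_le hβ1 (by linarith))
  have h := h₁ β hβ₁ ⌈β ^ (θ / 20)⌉₊ hT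
  rw [boxDirCircSqCov_eq_two_mul_sq, ← boxDirProjKernel_centre_eq] at h
  set K : ℝ := boxDirProjKernel ⌈β ^ θ⌉₊ (boxCentre ⌈β ^ θ⌉₊, 1, 2)
    (boxCentre ⌈β ^ θ⌉₊ + Pi.single 0 (⌈β ^ (θ / 20)⌉₊ : ℤ), 1, 2) with hK
  have h34 : (dimE ρ : ℝ) / 4 * (2 * K ^ 2) = (dimE ρ : ℝ) / 2 * K ^ 2 := by ring
  rw [h34] at h
  have hpow : β ^ (-(9 * θ)) ≤ β ^ (-(θ / 2)) := Real.rpow_le_rpow_of_exponent_le hβ1 (by linarith)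
  exact h.trans hpow

/-- **L1a without simplicity, at every `0 < θ ≤ 1/200`** (`0 < dimE ρ`): `GoodBoundaryCovStableG ρ (θ/20) θ (θ/5) (1/2)` — deep kernel
covariances under crude-good data are at least half the cold-wall one (`goodBoundaryCovStableG_at` fed by `kernelCovExpansionG_of_le`,
`flatCovExpansion_of_rep`, `stub_dirKernelTwoPoint`). -/
theorem goodBoundaryCovStable_explicit_of_dimE_pos (hρc : Continuous ρ) (hinj : Function.Injective ρ)
    (hρu : ∀ g, ρ g ∈ Matrix.unitaryGroup (Fin N) ℂ) (hD : 0 < dimE ρ) {θ : ℝ} (hθ : 0 < θ) (hθ2 : θ ≤ 1 / 200) :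
    GoodBoundaryCovStableG ρ (θ / 20) θ (θ / 5) (1 / 2) := by
  haveI : SecondCountableTopology (Matrix (Fin N) (Fin N) ℂ) := inferInstanceAs (SecondCountableTopology (Fin N → Fin N → ℂ))
  haveI : SecondCountableTopology G := (hρc.isClosedEmbedding hinj).isEmbedding.secondCountableTopology
  exact goodBoundaryCovStableG_at ρ (Nat.succ_le_of_lt hD) hθ
    (kernelCovExpansionG_of_le ρ hρc hinj hρu hD hθ hθ2) (flatCovExpansion_of_rep ρ hρc hinj hρu hθ (by linarith))
    (stub_dirKernelTwoPoint (θ / 20) θ (by positivity) (by linarith))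

/-- **L1b without simplicity, at every `0 < θ ≤ 1/200`** (`0 < dimE ρ`): `GoodBoundaryMeanSmoothG ρ (θ/20) θ (θ/5)`
(`goodBoundaryMeanSmoothG_at` fed by `kernelMeanExpansionG_of_dimE_pos` and `dirKernelDiagFlat`). -/
theorem goodBoundaryMeanSmooth_explicit_of_dimE_pos (hρc : Continuous ρ) (hinj : Function.Injective ρ)
    (hρu : ∀ g, ρ g ∈ Matrix.unitaryGroup (Fin N) ℂ) (hD : 0 < dimE ρ) {θ : ℝ} (hθ : 0 < θ) (hθ2 : θ ≤ 1 / 200) :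
    GoodBoundaryMeanSmoothG ρ (θ / 20) θ (θ / 5) :=
  goodBoundaryMeanSmoothG_at ρ hθ (kernelMeanExpansionG_of_dimE_pos ρ hρc hinj hρu hD hθ hθ2) dirKernelDiagFlat

/-- **L4 without simplicity, at every `0 < θ ≤ 1/100`** (`0 < dimE ρ`): `BoxPolyFloorG ρ (θ/20) θ (2 + θ/2)` — the cold-wall covariance is
eventually `≥ β^{−(2+θ/2)}` (`boxPolyFloorG_of_boxTwoPointDomination` fed by the BOX ceiling `boxTwoPointDomination_of_dimE_pos`). -/
theorem boxPolyFloor_explicit_of_dimE_pos (hρc : Continuous ρ) (hinj : Function.Injective ρ)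
    (hρu : ∀ g, ρ g ∈ Matrix.unitaryGroup (Fin N) ℂ) (hD : 0 < dimE ρ) {θ : ℝ} (hθ : 0 < θ) (hθ1 : θ ≤ 1 / 100) :
    BoxPolyFloorG ρ (θ / 20) θ (2 + θ / 2) :=
  boxPolyFloorG_of_boxTwoPointDomination ρ (θ₀ := 1 / 100)
    (fun _ _ hA hAθ hθ' => boxTwoPointDomination_of_dimE_pos ρ hρc hinj hρu hD hA hAθ hθ') hθ hθ1

end Rep

/-! ## 2. BULK at explicit windows without simplicity -/

/-- **BULK without simplicity, explicit window.**  For every compact `G` (any Borel structure), every faithful unitary lattice representation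
`r` with `0 < dimE r.ρ`, and every `0 < θ ≤ 1/200`: `BulkDominatesBox r.ρ (θ/20) θ` (DLR assembly L3-G `stub_dlrAssemblyG` at
`(A, δ, η₁, K) = (θ/20, θ/5, 1/2, 2 + θ/2)` on the four stubs above and L2-G `stub_largeFieldRarityG`).  The simple-`G` theorem
`bulkDominatesBox_allGroups_explicit` is the case `0 < dimE` supplied by `dimE_pos_of_isCompactSimpleLieGroup`.  NOT the Clay gap. -/
theorem bulkDominatesBox_explicit_of_dimE_pos
    (G : Type) [Group G] [TopologicalSpace G] [IsTopologicalGroup G] [CompactSpace G] [MeasurableSpace G] [BorelSpace G]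
    (r : LatticeRep G) (hD : 0 < dimE r.ρ) {θ : ℝ} (hθ : 0 < θ) (hθ2 : θ ≤ 1 / 200) :
    BulkDominatesBox r.ρ (θ / 20) θ :=
  stub_dlrAssemblyG G r (θ / 20) θ (θ / 5) (1 / 2) (2 + θ / 2) (by positivity) (by positivity) (by norm_num) (by linarith)
    (goodBoundaryCovStable_explicit_of_dimE_pos r.ρ r.continuous r.injective r.mem_unitary hD hθ hθ2)
    (goodBoundaryMeanSmooth_explicit_of_dimE_pos r.ρ r.continuous r.injective r.mem_unitary hD hθ hθ2)
    (stub_largeFieldRarityG G r (θ / 5) (by positivity))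
    (boxPolyFloor_explicit_of_dimE_pos r.ρ r.continuous r.injective r.mem_unitary hD hθ (by linarith))

/-- **BULK at EVERY small window without simplicity**: for every compact `G`, every `r` with `0 < dimE r.ρ`, all `0 < A ≤ 1/4000` and
`A < θ ≤ 1/100`, `BulkDominatesBox r.ρ A θ` (the explicit window `θ = 20A` re-windowed by the box-size transfer
`bulkDominatesBox_rewindow_of_dimE_pos`).  NOT the Clay gap. -/
theorem bulkDominatesBox_smallWindows_of_dimE_pos
    (G : Type) [Group G] [TopologicalSpace G] [IsTopologicalGroup G] [CompactSpace G] [MeasurableSpace G] [BorelSpace G]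
    (r : LatticeRep G) (hD : 0 < dimE r.ρ) {A θ : ℝ} (hA : 0 < A) (hA1 : A ≤ 1 / 4000) (hAθ : A < θ) (hθ1 : θ ≤ 1 / 100) :
    BulkDominatesBox r.ρ A θ := by
  have hbig : BulkDominatesBox r.ρ (20 * A / 20) (20 * A) :=
    bulkDominatesBox_explicit_of_dimE_pos G r hD (θ := 20 * A) (by positivity) (by linarith)
  rw [show 20 * A / 20 = A by ring] at hbig
  exact bulkDominatesBox_rewindow_of_dimE_pos r.ρ r.continuous r.injective r.mem_unitary hD hA
    (by linarith : A < 20 * A) (by linarith : 20 * A ≤ 1 / 100) hAθ hθ1 hbig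

/-- **BOX ∧ BULK at EVERY small window without simplicity**: for every compact `G`, every `r` with `0 < dimE r.ρ`, all `0 < A ≤ 1/4000` and
`A < θ ≤ 1/100`, `(∃ c > 0, BoxTwoPointDomination r.ρ A θ c) ∧ BulkDominatesBox r.ρ A θ`.  NOT the Clay gap. -/
theorem boxAndBulk_smallWindows_of_dimE_pos
    (G : Type) [Group G] [TopologicalSpace G] [IsTopologicalGroup G] [CompactSpace G] [MeasurableSpace G] [BorelSpace G]
    (r : LatticeRep G) (hD : 0 < dimE r.ρ) {A θ : ℝ} (hA : 0 < A) (hA1 : A ≤ 1 / 4000) (hAθ : A < θ) (hθ1 : θ ≤ 1 / 100) :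
    (∃ c : ℝ, 0 < c ∧ BoxTwoPointDomination r.ρ A θ c) ∧ BulkDominatesBox r.ρ A θ :=
  ⟨boxTwoPointDomination_of_dimE_pos r.ρ r.continuous r.injective r.mem_unitary hD hA hAθ hθ1,
    bulkDominatesBox_smallWindows_of_dimE_pos G r hD hA hA1 hAθ hθ1⟩

/-! ## 3. The rung with the explicit, uniform exponent `1/8000`, no simplicity -/

/-- **`ξ(β) ≥ β^{1/8000}` for every compact gauge group of positive chart dimension.**  For every compact `G` (any Borel structure) and every
faithful unitary lattice representation `r` with `0 < dimE r.ρ`: `MassGapPowerDecayOf 4 r.ρ (1/8000)` — for `β ≥ β₀(G, r)` every infinite-volume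
torus-limit state of the 4-D Wilson theory has RP-spectral mass gap `≤ β^{−1/8000}` in lattice units (BOX at `(A, θ) = (1/4000, 1/200)`:
`boxTwoPointDomination_of_dimE_pos`; BULK there: `bulkDominatesBox_smallWindows_of_dimE_pos`; FLOOR `curvatureCorrPowerFloor_proof`; glue
`massGapPowerDecayOf_of_box`, `ε = A/2`).  RECORD-label rung level; NOT the Clay Yang–Mills mass gap. -/
theorem massGapPowerDecay_explicit_of_dimE_pos
    (G : Type) [Group G] [TopologicalSpace G] [IsTopologicalGroup G] [CompactSpace G] [MeasurableSpace G] [BorelSpace G]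
    (r : LatticeRep G) (hD : 0 < dimE r.ρ) : MassGapPowerDecayOf 4 r.ρ (1 / 8000) := by
  obtain ⟨c, hc, hbox⟩ := boxTwoPointDomination_of_dimE_pos r.ρ r.continuous r.injective r.mem_unitary hD
    (A := 1 / 4000) (θ := 1 / 200) (by norm_num) (by norm_num) (by norm_num)
  have hbulk : BulkDominatesBox r.ρ (1 / 4000) (1 / 200) :=
    bulkDominatesBox_smallWindows_of_dimE_pos G r hD (by norm_num) le_rfl (by norm_num) (by norm_num)
  have h := massGapPowerDecayOf_of_box r.ρ r.continuous (by norm_num : (0 : ℝ) < 1 / 4000) hc hbox hbulk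
    curvatureCorrPowerFloor_proof
  rw [show (1 : ℝ) / 4000 / 2 = 1 / 8000 by norm_num] at h
  exact h

/-- **The quantifier-swapped, simplicity-free rung**: `∃ ε > 0` (`= 1/8000`) such that for EVERY compact `G` (any Borel structure) and EVERY
faithful unitary lattice representation `r` with `0 < dimE r.ρ`, `MassGapPowerDecayOf 4 r.ρ ε`.  Compare `xiPow_uniform` (compact simple `G`)
and `massGapPowerDecay_of_dimE_pos` (`∃ ε` depending on `(G, r)`).  RECORD-label rung level; NOT the Clay gap. -/
theorem xiPow_uniform_of_dimE_pos :
    ∃ ε : ℝ, 0 < ε ∧ ∀ (G : Type) [Group G] [TopologicalSpace G] [IsTopologicalGroup G] [CompactSpace G] [MeasurableSpace G]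
      [BorelSpace G] (r : LatticeRep G), 0 < dimE r.ρ → MassGapPowerDecayOf 4 r.ρ ε :=
  ⟨1 / 8000, by norm_num, fun G _ _ _ _ _ _ r hD => massGapPowerDecay_explicit_of_dimE_pos G r hD⟩

/-- **Every nontrivial connected compact group at `ε = 1/8000`**: for `G` compact, connected, nontrivial (any Borel structure) and every faithful
unitary lattice representation `r`, `MassGapPowerDecayOf 4 r.ρ (1/8000)` (`dimE_pos_of_connected_nontrivial`).  This covers `U(1)`, tori,
`U(N)`, `SO(N)`, `SU(N)` and every non-simple compact connected Lie group presented in some `U(N)`.  RECORD-label rung level; NOT the Clay gap. -/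
theorem massGapPowerDecay_explicit_of_connected
    (G : Type) [Group G] [TopologicalSpace G] [IsTopologicalGroup G] [CompactSpace G] [ConnectedSpace G] [Nontrivial G]
    [MeasurableSpace G] [BorelSpace G] (r : LatticeRep G) : MassGapPowerDecayOf 4 r.ρ (1 / 8000) :=
  massGapPowerDecay_explicit_of_dimE_pos G r (dimE_pos_of_connected_nontrivial G r)

/-- **Instance `U(N+1)`** (every faithful unitary lattice representation; `N = 0` is compact `U(1)` lattice gauge theory):
`MassGapPowerDecayOf 4 r.ρ (1/8000)`.  NOT the Clay gap. -/
theorem massGapPowerDecay_explicit_unitaryGroup (N : ℕ) (r : LatticeRep (Matrix.unitaryGroup (Fin (N + 1)) ℂ)) :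
    MassGapPowerDecayOf 4 r.ρ (1 / 8000) := by
  haveI := nontrivial_unitaryGroup N
  exact massGapPowerDecay_explicit_of_connected _ r

/-- **Instance: lattice QED₄ — `U(1) = Circle` in its defining representation `u1Rep`**: `MassGapPowerDecayOf 4 u1Rep (1/8000)`, i.e. every
torus-limit state of 4-D compact `U(1)` Wilson theory has RP-spectral gap `≤ β^{−1/8000}` at large `β`.  The weak-coupling phase of this
theory is massless (Guth 1980 / Fröhlich–Spencer 1982), so the rung's conclusion is far from sharp there: the BC5-type witness that the
R2xi-G method never sees non-abelian structure, now with the explicit exponent.  NOT the Clay gap. -/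
theorem massGapPowerDecay_explicit_u1Rep [MeasurableSpace Circle] [BorelSpace Circle] :
    MassGapPowerDecayOf 4 (G := Circle) u1Rep (1 / 8000) := by
  haveI := nontrivial_circle
  exact massGapPowerDecay_explicit_of_connected Circle ⟨1, u1Rep, continuous_u1Rep, u1Rep_injective, u1Rep_mem_unitaryGroup⟩

end Summit.QuantumFields.YangMills.Theorems.ColdBoxAllGroups

end
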